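import Summits.QuantumFields.BalabanUV.T4Continuum.Spine.NE9.MemoryFromRate

/-!
# T⁴ programme, spine estimate NE9 (node U3, history side) — KING'S CURRENCY FOR NODE U6: comparing the runs with cutoffs
# `K` and `K + n` DIRECTLY (n unpaired bare couplings, as in King's printed template) instead of telescoping through
# consecutive cutoffs, node U6 needs the scale-`m` bracket majorant to TEND TO ZERO (c₀), not to be SUMMABLE (ℓ¹); GIVEN
# tower-NE5 the E-side then owes only SEPARATE UNIFORM CONTINUITY of each scale-`m` term in each young coupling, PER LEVEL
# — census item C30 of cell `pub-balaban-gaps`, seat ne9 (gen 6)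

Cell `pub-balaban-gaps` (YM blitz G2, seat ne9, unit `pub-balaban-gaps-ne9-g6`; record `run/shared/lean/pub/pub-balaban-gaps/ne/NE9.md`
§5 row C30).  Summits-side bookkeeping on the ABSTRACT TOWER of gen 3's `MemoryFromRate` (`F : ℕ → (ℕ → ℝ) → ℝ`, `F m g` = the term of
the run in which a fixed physical localization domain has scale index `m`, decay factor stripped; window `W` shift- and hybrid-closed;
tower rate `hT`; by-name input `MemoryFromRate.osc_le_of_towerRate`).  No definition is made.

WHY.  Node U6 of the cell's spine (`T4CauchySum`) is organised CONSECUTIVELY: run A (`K` steps) against run B (`K + 1` steps), a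
matching remainder `δ_K` per pair, and `Summable δ` ⇒ `CauchySeq` (`T4CauchySum.cauchySeq_genFun`).  Its own printed template is
organised DIRECTLY: C. King, Commun. Math. Phys. **102** (1986), Thm 3.4 p. 656 bounds *"the difference of the effective actions S^{(k)}
and S^{(k+n)} generated from the lattices T_{ε_K} and T_{ε_{K+n}}"* (quoted in `T4CauchySum`'s docstring), i.e. runs `K` and `K + n` are
compared at once, and Cauchy-ness needs the remainder `δ_{K}` to tend to zero UNIFORMLY IN `n` — a c₀ condition, not an ℓ¹ one.  Gens 2–5 of
this seat measured what the E-side owes node U3 → U6 in the consecutive currency and found it two-sided minimal at «a QUANTITATIVE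
modulus of continuity in the young couplings» (`MemoryFromRateModulus` sufficient, `MemoryFromRateSharp` necessary: the SLOW TOWER with
bracket `≍ 1∕m` has `¬ Summable δ`).  This file re-measures in King's currency, on the same abstract tower:
* §1 `iter_towerRate`: `n` unpaired bare couplings cost `≤ C₅θ^m∕(1−θ)` UNIFORMLY IN `n` (the tower rate iterated vertically — the only
  place the geometric rate of NE5 is spent, and it is spent once).
* §2 `levelUniform_of_towerRate`: SEPARATE uniform continuity of `F m` in ONE coordinate, assumed PER LEVEL (uniform over the other
  coordinates only), is automatically uniform ACROSS LEVELS at each fixed AGE `a` — descend to a reference level through §1 (a 3ε argument;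
  finitely many low levels by a finite minimum).  No cross-level uniformity is an input.
* §3 `bracket_eventually_le`: tower rate + prefix dependence + per-level separate uniform continuity + a coordinatewise discrepancy profile
  `P i → 0` ⇒ for every `η > 0` there is a level `M₀` beyond which `|F m g − F m g'| ≤ η` for ALL admissible pairs with `|g_i − g'_i| ≤ P_i`
  (`i < m`): the old block (ages `> A`) by `osc_le_of_towerRate`, the young block by `A` single-coordinate steps (`chain_le`).  NO modulus,
  NO Lipschitz∕Hölder constant, NO holomorphy, NO rate.
* §4 `directBracket_eventually_le`: the same for the DIRECT bracket `|F (m+n) g − F m g'|` of runs `n` cutoffs apart, uniformly in `n`.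
* §5 the U2 dictionary: a K-uniform CONSECUTIVE matching profile `|t K i − t (K+1) (i+1)| ≤ p_i` with `Σ p < ∞` (the record's `C·θ^i` ✓,
  (E33g)'s `L·ρ^⌊√i⌋` ✓) gives the n-uniform DIRECT profile `P_i = Σ_{l} p_{l+i}` (tails), and `P_i → 0` (`tendsto_sum_nat_add`).
The U6 half (King-shape matching modulo constants with `δ_K → 0` ⇒ `CauchySeq genFun` + uniform convergence; `delta E ρ inj K → 0` from a
c₀ scale profile; the cell's consecutive socket IMPLIES King's) is the sibling file `DirectPairingCauchy`; the two-sided witnesses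
(the slow tower of `MemoryFromRateSharp` PASSES here; a continuous but not uniformly continuous tower FAILS) are `DirectPairingSharp`.

VERDICT FOR THE ROW.  In King's currency, GIVEN tower-NE5 and a summable K-uniform consecutive matching profile (both already assumed by
the spine), the E-side's debt to node U3 → U6 is: «each scale-`m` term is uniformly continuous in each of its young couplings, uniformly in
the other couplings — per level» — a QUALITATIVE statement whose printed TYPE for the last coupling is [Balaban1987RG1] p. 263 *"It is a
C^∞-function of g_{j−1} ∈ [0, γ]"* (continuity on the CLOSED interval gives uniform continuity), unprinted for the older couplings exactly
as NE9 is; gen 4's necessity verdict (C26) is relative to the cell's CONSECUTIVE organisation of node U6, not to the continuum limit.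
The classification of NE9 is UNCHANGED in kind (WORK-bound: the terms are Bałaban's one-step objects, instance 0∕1); what changes is that
NO CONSTANT of the one-step map is consumed on this route.  REGIME (honest): the polynomial-loss form `InjectedRate C c θ` with `c > 0` of
`T4CauchySum` §4 is NOT n-uniform and is excluded — a K-uniform summable consecutive profile is required (the two profiles of the cell
qualify); the other injected sources of node U6 (NE2∕NE3 η-rates, NE6 transport, NE7 matching) must be supplied for the pair (K, K+n)
— for geometric one-step sources this is the same geometric series as §1, for NE7 it is the same shape at the common last scale; none
of that is asserted here.

HONEST FRAMING: bookkeeping for rung (B)+1 on a FIXED finite four-torus; real analysis on hypothesis SHAPES; tower-NE5 is the cell's estimate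
NE5 (NOT PRINTED, NOT PROVED); NE9 NOT PRINTED ∕ NOT PROVED; spine PROVED 0∕9 unchanged; NOT UV stability, NOT the continuum limit, NOT
infinite volume, NOT a mass gap, NOT Clay.  HONEST DEPENDENCY: continuum YM on T⁴ ⇐ BetaPertH ∧ nine spine estimates (0∕9 proved).

References (TYPES only): [Balaban1987RG1] = T. Bałaban, Commun. Math. Phys. **109** (1987) 249–301, p. 263; [King1986] = C. King,
Commun. Math. Phys. **102** (1986) 649–677, Thm 3.4 (3.9) p. 656, p. 657.
-/

namespace Summit.QuantumFields.BalabanUV.T4Continuum.NE9.DirectPairing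

open scoped BigOperators
open Finset Filter Topology
open Summit.QuantumFields.BalabanUV.T4Continuum.NE9.MemoryFromRate (osc_le_of_towerRate)

variable {W : Set (ℕ → ℝ)} {F : ℕ → (ℕ → ℝ) → ℝ}

/-! ## §1 Iterated shifts; the tower rate iterated VERTICALLY (`n` unpaired bare couplings, uniformly in `n`) -/

/-- A shift-closed window is closed under every iterated shift `g ↦ (i ↦ g (i + l))`. [folklore] -/
theorem shift_iter_mem (hW : ∀ g ∈ W, (fun i => g (i + 1)) ∈ W) :
    ∀ (l : ℕ) (g : ℕ → ℝ), g ∈ W → (fun i => g (i + l)) ∈ W := by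
  intro l
  induction l with
  | zero => intro g hg; exact hg
  | succ l ih => intro g hg; exact ih (fun i => g (i + 1)) (hW g hg)

/-- A geometric threshold: for `0 ≤ θ < 1` and `ε > 0` there is a level beyond which `c·θ^m ≤ ε`. [folklore] -/
theorem exists_pow_le {θ : ℝ} (c : ℝ) {ε : ℝ} (hθ0 : 0 ≤ θ) (hθ1 : θ < 1) (hε : 0 < ε) :
    ∃ M : ℕ, ∀ m, M ≤ m → c * θ ^ m ≤ ε := by
  have ht : Tendsto (fun m : ℕ => c * θ ^ m) atTop (𝓝 0) := by
    simpa using (tendsto_pow_atTop_nhds_zero_of_lt_one hθ0 hθ1).const_mul c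
  obtain ⟨M, hM⟩ := Metric.tendsto_atTop.mp ht ε hε
  refine ⟨M, fun m hm => ?_⟩
  have h := hM m hm
  rw [Real.dist_eq, sub_zero] at h
  exact (le_abs_self _).trans h.le

/-- **VERTICAL ITERATION OF THE TOWER RATE** (finite-sum form): on a shift-closed window, `|F (m+n) g − F m (g ∘ (· + n))| ≤
C₅·Σ_{t<n} θ^{m+t}` — run `n` cutoffs finer, read at the same physical domain after dropping its `n` unpaired bare couplings. [folklore] -/
theorem iter_towerRate_sum {C₅ θ : ℝ}
    (hW : ∀ g ∈ W, (fun i => g (i + 1)) ∈ W)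
    (hT : ∀ m, ∀ g ∈ W, |F (m + 1) g - F m (fun i => g (i + 1))| ≤ C₅ * θ ^ m) :
    ∀ (n m : ℕ) (g : ℕ → ℝ), g ∈ W →
      |F (m + n) g - F m (fun i => g (i + n))| ≤ C₅ * ∑ t ∈ range n, θ ^ (m + t) := by
  intro n
  induction n with
  | zero =>
    intro m g _
    simp
  | succ n ih =>
    intro m g hg
    have h1 : |F (m + n + 1) g - F (m + n) (fun i => g (i + 1))| ≤ C₅ * θ ^ (m + n) := hT (m + n) g hg
    have h2 : |F (m + n) (fun i => g (i + 1)) - F m (fun i => g (i + n + 1))| ≤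
        C₅ * ∑ t ∈ range n, θ ^ (m + t) := ih m (fun i => g (i + 1)) (hW g hg)
    have e : (fun i => g (i + n + 1)) = fun i => g (i + (n + 1)) :=
      funext fun i => congrArg g (by omega)
    rw [e] at h2
    rw [sum_range_succ, mul_add, show m + (n + 1) = m + n + 1 from rfl]
    have t := abs_sub_le (F (m + n + 1) g) (F (m + n) fun i => g (i + 1)) (F m fun i => g (i + (n + 1)))
    linarith

/-- **VERTICAL ITERATION, GEOMETRIC FORM**: `|F (m+n) g − F m (g ∘ (· + n))| ≤ C₅θ^m∕(1−θ)`, UNIFORMLY IN `n` (`C₅ ≥ 0`, `0 ≤ θ < 1`) —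
the one place where the geometric rate of tower-NE5 is spent in King's currency. [folklore] -/
theorem iter_towerRate {C₅ θ : ℝ} (hC : 0 ≤ C₅) (hθ0 : 0 ≤ θ) (hθ1 : θ < 1)
    (hW : ∀ g ∈ W, (fun i => g (i + 1)) ∈ W)
    (hT : ∀ m, ∀ g ∈ W, |F (m + 1) g - F m (fun i => g (i + 1))| ≤ C₅ * θ ^ m)
    (n m : ℕ) {g : ℕ → ℝ} (hg : g ∈ W) :
    |F (m + n) g - F m (fun i => g (i + n))| ≤ C₅ * θ ^ m / (1 - θ) := by
  have h := iter_towerRate_sum hW hT n m g hg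
  have hs : ∑ t ∈ range n, θ ^ (m + t) ≤ θ ^ m / (1 - θ) := by
    have e : ∑ t ∈ range n, θ ^ (m + t) = θ ^ m * ∑ t ∈ range n, θ ^ t := by
      rw [mul_sum]
      exact sum_congr rfl fun t _ => pow_add θ m t
    rw [e, div_eq_mul_inv]
    exact mul_le_mul_of_nonneg_left
      (sum_le_hasSum _ (fun k _ => pow_nonneg hθ0 k) (hasSum_geometric_of_lt_one hθ0 hθ1)) (pow_nonneg hθ0 m)
  calc |F (m + n) g - F m (fun i => g (i + n))| ≤ C₅ * ∑ t ∈ range n, θ ^ (m + t) := h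
    _ ≤ C₅ * (θ ^ m / (1 - θ)) := mul_le_mul_of_nonneg_left hs hC
    _ = C₅ * θ ^ m / (1 - θ) := by ring

/-! ## §2 Separate uniform continuity PER LEVEL is uniform ACROSS LEVELS at each fixed age (3ε through the tower) -/

/-- **LEVEL-UNIFORMITY IS INHERITED FROM THE TOWER RATE.**  Assume, PER LEVEL `m` and coordinate `i < m`, that `F m` is uniformly continuous
in the coordinate `g_i`, uniformly over the other coordinates (`hUC`: for every `ε > 0` a `δ > 0` serving all admissible pairs that agree off
`i`).  Then for every AGE `a ≥ 1` and `ε > 0` ONE `δ > 0` serves ALL levels `m ≥ a` at the coordinate `m − a` of age `a`: descend from level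
`m = M + l` to a reference level `M` along `iter_towerRate` (cost `≤ C₅θ^M∕(1−θ)` twice; the shifted pair agrees off `M − a` with the same
discrepancy), use level `M`'s modulus there, and take a finite minimum over the levels `a ≤ m ≤ M`. [folklore] -/
theorem levelUniform_of_towerRate {C₅ θ : ℝ} (hC : 0 ≤ C₅) (hθ0 : 0 ≤ θ) (hθ1 : θ < 1)
    (hW : ∀ g ∈ W, (fun i => g (i + 1)) ∈ W)
    (hT : ∀ m, ∀ g ∈ W, |F (m + 1) g - F m (fun i => g (i + 1))| ≤ C₅ * θ ^ m)
    (hUC : ∀ m i : ℕ, i < m → ∀ ε : ℝ, 0 < ε → ∃ δ : ℝ, 0 < δ ∧ ∀ g ∈ W, ∀ g' ∈ W,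
      (∀ k, k ≠ i → g k = g' k) → |g i - g' i| ≤ δ → |F m g - F m g'| ≤ ε)
    {a : ℕ} (ha : 1 ≤ a) {ε : ℝ} (hε : 0 < ε) :
    ∃ δ : ℝ, 0 < δ ∧ ∀ m : ℕ, a ≤ m → ∀ g ∈ W, ∀ g' ∈ W,
      (∀ k, k ≠ m - a → g k = g' k) → |g (m - a) - g' (m - a)| ≤ δ → |F m g - F m g'| ≤ ε := by
  -- a reference level `M ≥ a` with `C₅θ^M∕(1−θ) ≤ ε∕3`
  obtain ⟨M₁, hM₁⟩ := exists_pow_le (C₅ / (1 - θ)) hθ0 hθ1 (show 0 < ε / 3 by positivity)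
  obtain ⟨M, hMM, hMa⟩ : ∃ M, M₁ ≤ M ∧ a ≤ M := ⟨max M₁ a, le_max_left _ _, le_max_right _ _⟩
  -- the per-level moduli at age `a`, as a function of the level (dummy value below `a`)
  have hlev : ∀ m : ℕ, ∃ δ : ℝ, 0 < δ ∧ (a ≤ m → ∀ g ∈ W, ∀ g' ∈ W,
      (∀ k, k ≠ m - a → g k = g' k) → |g (m - a) - g' (m - a)| ≤ δ → |F m g - F m g'| ≤ ε / 3) := by
    intro m
    by_cases ham : a ≤ m
    · obtain ⟨δ, hδ, h⟩ := hUC m (m - a) (by omega) (ε / 3) (by positivity)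
      exact ⟨δ, hδ, fun _ => h⟩
    · exact ⟨1, one_pos, fun h => absurd h ham⟩
  choose δf hδf hF using hlev
  refine ⟨(range (M + 1)).inf' ⟨0, by simp⟩ δf, (Finset.lt_inf'_iff _).2 fun m _ => hδf m, ?_⟩
  intro m ham g hg g' hg' hagree hdiff
  by_cases hmM : m ≤ M
  · -- a low level: its own modulus
    have hδm : (range (M + 1)).inf' ⟨0, by simp⟩ δf ≤ δf m := Finset.inf'_le δf (mem_range.2 (by omega))
    have := hF m ham g hg g' hg' hagree (hdiff.trans hδm)
    linarith
  · -- a high level `m = M + l`: descend to `M`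
    obtain ⟨l, rfl⟩ := Nat.exists_eq_add_of_le (le_of_lt (not_le.mp hmM))
    have hgl : (fun i => g (i + l)) ∈ W := shift_iter_mem hW l g hg
    have hg'l : (fun i => g' (i + l)) ∈ W := shift_iter_mem hW l g' hg'
    have hdesc : C₅ / (1 - θ) * θ ^ M ≤ ε / 3 := hM₁ M hMM
    have d1 := iter_towerRate hC hθ0 hθ1 hW hT l M hg
    have d2 := iter_towerRate hC hθ0 hθ1 hW hT l M hg'
    have e1 : C₅ * θ ^ M / (1 - θ) = C₅ / (1 - θ) * θ ^ M := by ring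
    rw [e1] at d1 d2
    have hδM : (range (M + 1)).inf' ⟨0, by simp⟩ δf ≤ δf M := Finset.inf'_le δf (by simp)
    have hmid : |F M (fun i => g (i + l)) - F M (fun i => g' (i + l))| ≤ ε / 3 := by
      refine hF M hMa _ hgl _ hg'l (fun k hk => hagree (k + l) (by omega)) ?_
      show |g (M - a + l) - g' (M - a + l)| ≤ δf M
      rw [show M - a + l = M + l - a by omega]
      exact hdiff.trans hδM
    have t1 := abs_sub_le (F (M + l) g) (F M fun i => g (i + l)) (F (M + l) g')
    have t2 := abs_sub_le (F M fun i => g (i + l)) (F M fun i => g' (i + l)) (F (M + l) g')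
    rw [abs_sub_comm] at d2
    linarith

/-! ## §3 The bracket majorant TENDS TO ZERO from separate uniform continuity (young block) and the tower rate (old block) -/

/-- **THE HYBRID CHAIN.**  On a hybrid-closed window, if every single-coordinate change at an index `i ∈ [a, m)` between admissible
histories, of size `≤ P_i`, moves `F m` by at most `c`, then walking from the hybrid `(g' below a, g above)` to the hybrid
`(g' below a + k, g above)` costs `≤ k·c` (`a + k ≤ m`; one coordinate per step). [folklore] -/
theorem chain_le {m a : ℕ} {P : ℕ → ℝ} {c : ℝ}
    (hWmix : ∀ g ∈ W, ∀ g' ∈ W, ∀ a : ℕ, (fun i => if i < a then g' i else g i) ∈ W)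
    {g g' : ℕ → ℝ} (hg : g ∈ W) (hg' : g' ∈ W)
    (hstep : ∀ i : ℕ, a ≤ i → i < m → ∀ h ∈ W, ∀ h' ∈ W,
      (∀ k, k ≠ i → h k = h' k) → |h i - h' i| ≤ P i → |F m h - F m h'| ≤ c)
    (hd : ∀ i : ℕ, a ≤ i → i < m → |g i - g' i| ≤ P i) :
    ∀ k : ℕ, a + k ≤ m →
      |F m (fun i => if i < a then g' i else g i) - F m (fun i => if i < a + k then g' i else g i)| ≤ (k : ℝ) * c := by
  intro k
  induction k with
  | zero => intro _; simp
  | succ k ih =>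
    intro hk
    have h1 := ih (by omega)
    have hmemk : (fun i => if i < a + k then g' i else g i) ∈ W := hWmix g hg g' hg' (a + k)
    have hmemk1 : (fun i => if i < a + k + 1 then g' i else g i) ∈ W := hWmix g hg g' hg' (a + k + 1)
    have h2 : |F m (fun i => if i < a + k then g' i else g i) -
        F m (fun i => if i < a + k + 1 then g' i else g i)| ≤ c := by
      refine hstep (a + k) (by omega) (by omega) _ hmemk _ hmemk1 (fun j hj => ?_) ?_
      · by_cases hj1 : j < a + k
        · simp [hj1, show j < a + k + 1 by omega]
        · simp [hj1, show ¬ (j < a + k + 1) by omega]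
      · simp only [lt_irrefl, if_false, show a + k < a + k + 1 by omega, if_true]
        exact hd (a + k) (by omega) (by omega)
    have t := abs_sub_le (F m fun i => if i < a then g' i else g i) (F m fun i => if i < a + k then g' i else g i)
      (F m fun i => if i < a + k + 1 then g' i else g i)
    rw [show a + (k + 1) = a + k + 1 from rfl]
    push_cast
    linarith

/-- **THE BRACKET MAJORANT TENDS TO ZERO** (King's currency, E-side).  Tower rate (`C₅ ≥ 0`, `0 ≤ θ < 1`) on a shift- and hybrid-closed
window + prefix dependence (`F m` reads the couplings `< m` only) + SEPARATE UNIFORM CONTINUITY PER LEVEL (`hUC`) + a coordinatewise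
discrepancy profile with `P i → 0`: for every `η > 0` there is `M₀` such that for all levels `m ≥ M₀` and all admissible pairs with
`|g_i − g'_i| ≤ P_i` (`i < m`), `|F m g − F m g'| ≤ η`.  Old block (indices `< m − A`): `osc_le_of_towerRate`, `2C₅θ^A∕(1−θ) ≤ η∕2`; young
block (the `A` ages `1..A`): `A` single-coordinate steps of cost `η∕(2A)` each, by `levelUniform_of_towerRate` once `P_i` is below the
finite minimum of the `A` moduli.  NO modulus, NO constant, NO rate on the E-side. [folklore] -/
theorem bracket_eventually_le {C₅ θ : ℝ} {P : ℕ → ℝ} (hC : 0 ≤ C₅) (hθ0 : 0 ≤ θ) (hθ1 : θ < 1)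
    (hW : ∀ g ∈ W, (fun i => g (i + 1)) ∈ W)
    (hWmix : ∀ g ∈ W, ∀ g' ∈ W, ∀ a : ℕ, (fun i => if i < a then g' i else g i) ∈ W)
    (hT : ∀ m, ∀ g ∈ W, |F (m + 1) g - F m (fun i => g (i + 1))| ≤ C₅ * θ ^ m)
    (hP : ∀ m, ∀ g ∈ W, ∀ g' ∈ W, (∀ i, i < m → g i = g' i) → F m g = F m g')
    (hUC : ∀ m i : ℕ, i < m → ∀ ε : ℝ, 0 < ε → ∃ δ : ℝ, 0 < δ ∧ ∀ g ∈ W, ∀ g' ∈ W,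
      (∀ k, k ≠ i → g k = g' k) → |g i - g' i| ≤ δ → |F m g - F m g'| ≤ ε)
    (hd : Tendsto P atTop (𝓝 0)) {η : ℝ} (hη : 0 < η) :
    ∃ M₀ : ℕ, ∀ m : ℕ, M₀ ≤ m → ∀ g ∈ W, ∀ g' ∈ W,
      (∀ i, i < m → |g i - g' i| ≤ P i) → |F m g - F m g'| ≤ η := by
  -- old block: an age cut-off `A ≥ 1` with `2C₅θ^A∕(1−θ) ≤ η∕2`
  obtain ⟨A₁, hA₁⟩ := exists_pow_le (2 * C₅ / (1 - θ)) hθ0 hθ1 (half_pos hη)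
  obtain ⟨A, hAA, hA1⟩ : ∃ A, A₁ ≤ A ∧ 1 ≤ A := ⟨max A₁ 1, le_max_left _ _, le_max_right _ _⟩
  have hAold : 2 * C₅ / (1 - θ) * θ ^ A ≤ η / 2 := hA₁ A hAA
  have hApos : (0 : ℝ) < A := by exact_mod_cast hA1
  -- young block: level-uniform moduli for the ages `1..A` at tolerance `η∕(2A)` (dummy value at age `0`)
  have hage : ∀ a : ℕ, ∃ δ : ℝ, 0 < δ ∧ (1 ≤ a → ∀ m : ℕ, a ≤ m → ∀ g ∈ W, ∀ g' ∈ W,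
      (∀ k, k ≠ m - a → g k = g' k) → |g (m - a) - g' (m - a)| ≤ δ → |F m g - F m g'| ≤ η / (2 * A)) := by
    intro a
    by_cases ha : 1 ≤ a
    · obtain ⟨δ, hδ, h⟩ :=
        levelUniform_of_towerRate hC hθ0 hθ1 hW hT hUC ha (show 0 < η / (2 * A) by positivity)
      exact ⟨δ, hδ, fun _ => h⟩
    · exact ⟨1, one_pos, fun h => absurd h ha⟩
  choose δa hδa hFa using hage
  have hδpos : 0 < (range (A + 1)).inf' ⟨0, by simp⟩ δa := (Finset.lt_inf'_iff _).2 fun a _ => hδa a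
  have hδle : ∀ a, a ≤ A → (range (A + 1)).inf' ⟨0, by simp⟩ δa ≤ δa a :=
    fun a ha => Finset.inf'_le δa (mem_range.2 (by omega))
  -- the profile is eventually below the finite minimum of the moduli
  obtain ⟨I, hI⟩ := Metric.tendsto_atTop.mp hd _ hδpos
  have hPI : ∀ i, I ≤ i → P i ≤ (range (A + 1)).inf' ⟨0, by simp⟩ δa := fun i hi => by
    have h := hI i hi
    rw [Real.dist_eq, sub_zero] at h
    exact (le_abs_self _).trans h.le
  refine ⟨I + A, fun m hm g hg g' hg' hgg' => ?_⟩
  -- old block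
  have hh₀W : (fun i => if i < m - A then g' i else g i) ∈ W := hWmix g hg g' hg' (m - A)
  have hold : |F m g - F m (fun i => if i < m - A then g' i else g i)| ≤ η / 2 := by
    have h := osc_le_of_towerRate (F := F) hC hθ0 hθ1 hW hT (a := m - A) (m := A) hg hh₀W
      (fun i hi => by simp [not_lt.mpr hi])
    rw [show A + (m - A) = m by omega] at h
    calc |F m g - F m (fun i => if i < m - A then g' i else g i)| ≤ 2 * C₅ * θ ^ A / (1 - θ) := h
      _ = 2 * C₅ / (1 - θ) * θ ^ A := by ring
      _ ≤ η / 2 := hAold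
  -- young block: `A` single-coordinate steps
  have hyoung : |F m (fun i => if i < m - A then g' i else g i) -
      F m (fun i => if i < m - A + A then g' i else g i)| ≤ (A : ℝ) * (η / (2 * A)) := by
    refine chain_le hWmix hg hg' (fun i hi1 hi2 h hh h' hh' hagree hdi => ?_)
      (fun i _ hi2 => hgg' i hi2) A (by omega)
    -- the coordinate `i` has age `m − i ∈ [1, A]` at level `m`
    have him : m - (m - i) = i := by omega
    refine hFa (m - i) (by omega) m (by omega) h hh h' hh' (by rw [him]; exact hagree) ?_
    rw [him]
    exact hdi.trans ((hPI i (by omega)).trans (hδle _ (by omega)))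
  -- the last hybrid agrees with `g'` below `m`
  have hlast : F m (fun i => if i < m - A + A then g' i else g i) = F m g' :=
    hP m _ (hWmix g hg g' hg' _) g' hg' (fun i hi => by simp [show i < m - A + A by omega])
  have eA : (A : ℝ) * (η / (2 * A)) = η / 2 := by
    field_simp
  rw [hlast, eA] at hyoung
  have t := abs_sub_le (F m g) (F m fun i => if i < m - A then g' i else g i) (F m g')
  linarith

/-! ## §4 The DIRECT bracket of runs `n` cutoffs apart, uniformly in `n` -/

/-- **KING'S CURRENCY, E-SIDE END.**  Under the hypotheses of `bracket_eventually_le`: for every `η > 0` there is `M₀` such that for all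
`m ≥ M₀`, ALL `n`, and all admissible `g` (run `n` cutoffs finer, `n` unpaired bare couplings `g_0 … g_{n−1}`) and `g'` with
`|g_{i+n} − g'_i| ≤ P_i` (`i < m`): `|F (m+n) g − F m g'| ≤ η`.  The unpaired couplings cost `C₅θ^m∕(1−θ)` by `iter_towerRate`, the paired
ones `bracket_eventually_le`.  This is the n-UNIFORM scale-`m` bracket King's organisation of node U6 consumes (sibling `DirectPairingCauchy`).
[folklore] -/
theorem directBracket_eventually_le {C₅ θ : ℝ} {P : ℕ → ℝ} (hC : 0 ≤ C₅) (hθ0 : 0 ≤ θ) (hθ1 : θ < 1)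
    (hW : ∀ g ∈ W, (fun i => g (i + 1)) ∈ W)
    (hWmix : ∀ g ∈ W, ∀ g' ∈ W, ∀ a : ℕ, (fun i => if i < a then g' i else g i) ∈ W)
    (hT : ∀ m, ∀ g ∈ W, |F (m + 1) g - F m (fun i => g (i + 1))| ≤ C₅ * θ ^ m)
    (hP : ∀ m, ∀ g ∈ W, ∀ g' ∈ W, (∀ i, i < m → g i = g' i) → F m g = F m g')
    (hUC : ∀ m i : ℕ, i < m → ∀ ε : ℝ, 0 < ε → ∃ δ : ℝ, 0 < δ ∧ ∀ g ∈ W, ∀ g' ∈ W,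
      (∀ k, k ≠ i → g k = g' k) → |g i - g' i| ≤ δ → |F m g - F m g'| ≤ ε)
    (hd : Tendsto P atTop (𝓝 0)) {η : ℝ} (hη : 0 < η) :
    ∃ M₀ : ℕ, ∀ m : ℕ, M₀ ≤ m → ∀ n : ℕ, ∀ g ∈ W, ∀ g' ∈ W,
      (∀ i, i < m → |g (i + n) - g' i| ≤ P i) → |F (m + n) g - F m g'| ≤ η := by
  obtain ⟨M₁, hM₁⟩ := exists_pow_le (C₅ / (1 - θ)) hθ0 hθ1 (half_pos hη)
  obtain ⟨M₂, hM₂⟩ := bracket_eventually_le hC hθ0 hθ1 hW hWmix hT hP hUC hd (half_pos hη)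
  refine ⟨max M₁ M₂, fun m hm n g hg g' hg' hgg' => ?_⟩
  have h1 := iter_towerRate hC hθ0 hθ1 hW hT n m hg
  have h2 := hM₂ m (le_of_max_le_right hm) (fun i => g (i + n)) (shift_iter_mem hW n g hg) g' hg' hgg'
  have h3 : C₅ * θ ^ m / (1 - θ) ≤ η / 2 := by
    rw [show C₅ * θ ^ m / (1 - θ) = C₅ / (1 - θ) * θ ^ m by ring]
    exact hM₁ m (le_of_max_le_left hm)
  have t := abs_sub_le (F (m + n) g) (F m fun i => g (i + n)) (F m g')
  linarith

/-! ## §5 The U2 dictionary: tails of a summable CONSECUTIVE matching profile are an n-uniform DIRECT profile tending to zero -/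

/-- From a K-uniform consecutive matching profile `|t K i − t (K+1) (i+1)| ≤ p_i` (node U2's output between runs of `K` and `K + 1` steps,
scale `i` of the coarser run paired with scale `i + 1` of the finer), the runs `n` cutoffs apart match within `Σ_{l<n} p_{i+l}`
(telescoping through the intermediate runs). [folklore] -/
theorem abs_sub_le_sum_of_consecutive {t : ℕ → ℕ → ℝ} {p : ℕ → ℝ}
    (hp : ∀ K i, |t K i - t (K + 1) (i + 1)| ≤ p i) :
    ∀ (n K i : ℕ), |t K i - t (K + n) (i + n)| ≤ ∑ l ∈ range n, p (i + l) := by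
  intro n
  induction n with
  | zero => intro K i; simp
  | succ n ih =>
    intro K i
    rw [sum_range_succ, show K + (n + 1) = K + n + 1 from rfl, show i + (n + 1) = i + n + 1 from rfl]
    have h1 := ih K i
    have h2 := hp (K + n) (i + n)
    have t3 := abs_sub_le (t K i) (t (K + n) (i + n)) (t (K + n + 1) (i + n + 1))
    linarith

/-- … hence, for a nonnegative summable profile, within the TAIL `P_i = Σ_l p_{l+i}`, UNIFORMLY in `n` and `K`. [folklore] -/
theorem abs_sub_le_tail_of_consecutive {t : ℕ → ℕ → ℝ} {p : ℕ → ℝ}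
    (hp : ∀ K i, |t K i - t (K + 1) (i + 1)| ≤ p i) (hp0 : ∀ i, 0 ≤ p i) (hps : Summable p) (n K i : ℕ) :
    |t K i - t (K + n) (i + n)| ≤ ∑' l, p (l + i) := by
  refine (abs_sub_le_sum_of_consecutive hp n K i).trans ?_
  have hs : Summable (fun l => p (l + i)) := (summable_nat_add_iff i).2 hps
  calc ∑ l ∈ range n, p (i + l) = ∑ l ∈ range n, p (l + i) := sum_congr rfl fun l _ => by rw [add_comm]
    _ ≤ ∑' l, p (l + i) := hs.sum_le_tsum _ fun l _ => hp0 _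

/-- The tails of any real sequence's series tend to zero (`tendsto_sum_nat_add`): the direct profile `P_i = Σ_l p_{l+i}` is admissible
in `bracket_eventually_le` ∕ `directBracket_eventually_le`. [folklore] -/
theorem tendsto_tail (p : ℕ → ℝ) : Tendsto (fun i => ∑' l, p (l + i)) atTop (𝓝 0) :=
  tendsto_sum_nat_add p

/-- **ASSEMBLED (E-side, King's currency, U2 input in consecutive form).**  Tower rate + prefix dependence + separate uniform continuity per
level + a nonnegative SUMMABLE K-uniform consecutive matching profile `p` for a family of coupling histories `t K` (`t K ∈ W`): for every
`η > 0` there is `M₀` with `|F (m+n) (t (K+n)) − F m (t K)| ≤ η` for all `m ≥ M₀`, all `K` and all `n` — the histories of the runs with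
`K + n` and `K` steps compared DIRECTLY at every late scale, uniformly in the gap `n`. [folklore] -/
theorem directBracket_eventually_le_of_consecutive {C₅ θ : ℝ} {p : ℕ → ℝ} {t : ℕ → ℕ → ℝ}
    (hC : 0 ≤ C₅) (hθ0 : 0 ≤ θ) (hθ1 : θ < 1)
    (hW : ∀ g ∈ W, (fun i => g (i + 1)) ∈ W)
    (hWmix : ∀ g ∈ W, ∀ g' ∈ W, ∀ a : ℕ, (fun i => if i < a then g' i else g i) ∈ W)
    (hT : ∀ m, ∀ g ∈ W, |F (m + 1) g - F m (fun i => g (i + 1))| ≤ C₅ * θ ^ m)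
    (hP : ∀ m, ∀ g ∈ W, ∀ g' ∈ W, (∀ i, i < m → g i = g' i) → F m g = F m g')
    (hUC : ∀ m i : ℕ, i < m → ∀ ε : ℝ, 0 < ε → ∃ δ : ℝ, 0 < δ ∧ ∀ g ∈ W, ∀ g' ∈ W,
      (∀ k, k ≠ i → g k = g' k) → |g i - g' i| ≤ δ → |F m g - F m g'| ≤ ε)
    (ht : ∀ K, t K ∈ W) (hp : ∀ K i, |t (K + 1) (i + 1) - t K i| ≤ p i) (hp0 : ∀ i, 0 ≤ p i) (hps : Summable p)
    {η : ℝ} (hη : 0 < η) :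
    ∃ M₀ : ℕ, ∀ m : ℕ, M₀ ≤ m → ∀ K n : ℕ, |F (m + n) (t (K + n)) - F m (t K)| ≤ η := by
  obtain ⟨M₀, hM₀⟩ := directBracket_eventually_le hC hθ0 hθ1 hW hWmix hT hP hUC (tendsto_tail p) hη
  refine ⟨M₀, fun m hm K n => hM₀ m hm n (t (K + n)) (ht _) (t K) (ht _) fun i _ => ?_⟩
  -- `|t (K+n) (i+n) − t K i| ≤ Σ_l p_{l+i}`, by the consecutive telescoping read backwards
  have hp' : ∀ K i, |(fun K i => t K i) K i - (fun K i => t K i) (K + 1) (i + 1)| ≤ p i := fun K i => by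
    rw [abs_sub_comm]
    exact hp K i
  have h := abs_sub_le_tail_of_consecutive hp' hp0 hps n K i
  rw [abs_sub_comm] at h
  exact h

end Summit.QuantumFields.BalabanUV.T4Continuum.NE9.DirectPairing
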